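import Mathlib
import HarnessLib
import Literature.MathematicalPhysics.StatisticalMechanics.ComplexGradientStiffness
import Summits.HubbardSuperconductivity.HubbardSuperconductivity.Theorems.ComplexGFFStiffnessDefs

/-!
# Crux `HypACumulant`, line `gnv` — calculus of the complex single-site perturbation `𝒦_g`

Route `route-HubbardSuperconductivity-ComplexGFFStiffness`, crux item stmt-HubbardSuperconductivity-19154
(`…Theses.ComplexGFFStiffness.HypACumulant`; the first rung `ZNonvanishing` is shared with
stmt-…-19155).  First half of the reduction of the registered stub `stub_zNonvanishing` to the
line's research stub `GNV` (`…Theorems.ComplexGFF.GNV`): the model-specific algebra and calculus of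
`𝒦_g(z) = exp(−i g 𝒜(z)) − 1`, `𝒜(z) = z_0 (z_1² + z_2² + z_3²)` (`…Theorems.ComplexGFF.pertK`,
`berryVertex`).

## Contents (all proved; no definition, no named fact)
* `pertZ_pertK : pertZ n (pertK g) = Z n g 0` — the model IS an instance of the perturbed partition
  function: `w_{g,0}(φ) = e^{−S_0(φ)} ∏_x (1 + 𝒦_g(∇φ(x)))`;
* `pertK_neg` — the `ι`-symmetry `𝒦_g(−z) = conj 𝒦_g(z)`; `pertK_eq_comp_smul` — the homogeneity
  `𝒦_g = 𝒦_1 ∘ (c·id)` for `c³ = g`;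
* `norm_iteratedFDeriv_berryVertex_le` — `‖D^i 𝒜(z)‖ ≤ 18 (1+‖z‖)²` for `i ≥ 1` (`𝒜` factors
  through a trilinear form of norm `≤ 3`; Mathlib's bound for derivatives of multilinear maps);
* `norm_iteratedFDeriv_cexp` — every real-Fréchet derivative of `exp : ℂ → ℂ` at `w` has norm
  `e^{Re w}`; `norm_iteratedFDeriv_pertK_one_le` — `‖D^k 𝒦_1(y)‖ ≤ k!·(18(1+‖y‖)²)^k` (`k ≥ 1`,
  Mathlib's bound for derivatives of a composition); `norm_iteratedFDeriv_pertK_le_scaled` —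
  `‖D^k 𝒦_g(z)‖ ≤ ‖D^k 𝒦_1(cz)‖ |c|^k`; `norm_pertK_le` — `‖𝒦_g(z)‖ ≤ 3 g ‖z‖³`.
The uniform bound, admissibility and `GNV → ZNonvanishing` follow in
`ComplexGFFStiffnessHypACumulantZOfGNV.lean`.

## References
* S. Adams, S. Buchholz, R. Kotecký, S. Müller, arXiv:1910.13564, Sec. 2.1 (the space `E_{ζ,𝒬}`
  of finite-range perturbations; here complexified and `ι`-symmetric).
-/

noncomputable section

-- `Summit.<Summit>.<Problem>`: single-conjunct summit, the duplicate component is mandated (D-0017).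
set_option linter.dupNamespace false

namespace Summit.HubbardSuperconductivity.HubbardSuperconductivity.Theorems.ComplexGFF

open scoped BigOperators ComplexConjugate
open MeasureTheory
open Literature.MathematicalPhysics.StatisticalMechanics.ComplexGradientGFF4 (Z ev Y D S X w)

/-! ### The model's weight is `e^{−S_0} ∏_x (1 + 𝒦_g(∇φ(x)))` -/

variable {n : ℕ}

/-- `X_0(φ) = Σ_x 𝒜(∇φ(x))`: the Berry vertex at zero tilt is the lattice sum of the local cubic
form `berryVertex` of the forward gradients. -/
theorem X_zero_eq_sum_berryVertex [NeZero n] (φ : (Fin 4 → ZMod n) → ℝ) :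
    X 0 φ = ∑ x : Fin 4 → ZMod n, berryVertex (fun i => D φ i x) := by
  unfold X berryVertex
  simp only [Pi.zero_apply, add_zero]

/-- The untilted complex weight factorises over sites:
`w_{g,0}(φ) = e^{−S_0(φ)} ∏_x (1 + 𝒦_g(∇φ(x)))`. -/
theorem w_zero_eq_exp_mul_prod [NeZero n] (g : ℝ) (φ : (Fin 4 → ZMod n) → ℝ) :
    w g 0 φ = Complex.exp (-((S 0 φ : ℝ) : ℂ))
      * ∏ x : Fin 4 → ZMod n, (1 + pertK g (fun i => D φ i x)) := by
  unfold w pertK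
  simp only [add_sub_cancel]
  rw [← Complex.exp_sum, ← Complex.exp_add, X_zero_eq_sum_berryVertex]
  congr 1
  rw [Finset.mul_sum]
  push_cast
  rw [Finset.mul_sum, Finset.sum_neg_distrib]
  ring

/-- **The model is an instance:** `pertZ n (pertK g) = Z_n(g,0)` on every torus. -/
theorem pertZ_pertK [NeZero n] (g : ℝ) : pertZ n (pertK g) = Z n g 0 := by
  unfold pertZ Z
  exact integral_congr_ae (Filter.Eventually.of_forall (fun φ => (w_zero_eq_exp_mul_prod g φ).symm))

/-! ### `ι`-symmetry and homogeneity of the perturbation -/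

/-- `𝒜` is odd. -/
theorem berryVertex_neg (z : Fin 4 → ℝ) : berryVertex (-z) = -berryVertex z := by
  unfold berryVertex
  simp only [Pi.neg_apply, even_two, Even.neg_pow]
  ring

/-- `𝒜` is homogeneous of degree three. -/
theorem berryVertex_smul (c : ℝ) (z : Fin 4 → ℝ) : berryVertex (c • z) = c ^ 3 * berryVertex z := by
  unfold berryVertex
  simp only [Pi.smul_apply, smul_eq_mul, Finset.mul_sum]
  refine Finset.sum_congr rfl (fun j _ => ?_)
  ring

/-- **`ι`-symmetry:** `𝒦_g(−z) = conj 𝒦_g(z)`. -/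
theorem pertK_neg (g : ℝ) (z : Fin 4 → ℝ) : pertK g (-z) = conj (pertK g z) := by
  unfold pertK
  rw [berryVertex_neg, map_sub, map_one, ← Complex.exp_conj]
  congr 2
  rw [map_neg, map_mul, Complex.conj_I, Complex.conj_ofReal]
  push_cast
  ring

/-- homogeneity: `𝒦_g = 𝒦_1 ∘ (c • id)` whenever `c³ = g`. -/
theorem pertK_eq_comp_smul {g c : ℝ} (hc : c ^ 3 = g) :
    pertK g = pertK 1 ∘ (fun z => (c • ContinuousLinearMap.id ℝ (Fin 4 → ℝ)) z) := by
  funext z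
  simp only [Function.comp_apply, FunLike.coe_smul, Pi.smul_apply,
    ContinuousLinearMap.coe_id', id, pertK, berryVertex_smul, hc, one_mul]

/-! ### Derivative bounds for the cubic vertex
`𝒜 = M ∘ Δ` for a trilinear form `M` on `(ℝ⁴)³` of norm `≤ 3` and the diagonal `Δ(z) = (z,z,z)`,
so `‖D^i 𝒜(z)‖ ≤ 3!·3·‖z‖^{3−i} ≤ 18 (1 + ‖z‖)²` for `i ≥ 1` (Mathlib's bound for the derivatives
of a continuous multilinear map). -/

/-- `𝒜` factors through a trilinear form of norm `≤ 3` and the diagonal embedding (norm `≤ 1`,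
isometric on vectors). -/
theorem berryVertex_eq_multilinear_comp :
    ∃ (M : ContinuousMultilinearMap ℝ (fun _ : Fin 3 => (Fin 4 → ℝ)) ℝ)
      (T : (Fin 4 → ℝ) →L[ℝ] (Fin 3 → (Fin 4 → ℝ))),
      ‖M‖ ≤ 3 ∧ ‖T‖ ≤ 1 ∧ (∀ z, ‖T z‖ = ‖z‖) ∧ berryVertex = (fun v => M v) ∘ (fun z => T z) := by
  classical
  -- the `j`-th term `(v₀)_0 (v₁)_j (v₂)_j`, legs indexed by `leg j i`
  let leg : Fin 3 → Fin 3 → Fin 4 := fun j i => if i = 0 then 0 else j.succ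
  let M : ContinuousMultilinearMap ℝ (fun _ : Fin 3 => (Fin 4 → ℝ)) ℝ :=
    ∑ j : Fin 3, (ContinuousMultilinearMap.mkPiAlgebraFin ℝ 3 ℝ).compContinuousLinearMap
      (fun i : Fin 3 => ContinuousLinearMap.proj (R := ℝ) (φ := fun _ : Fin 4 => ℝ) (leg j i))
  let T : (Fin 4 → ℝ) →L[ℝ] (Fin 3 → (Fin 4 → ℝ)) :=
    ContinuousLinearMap.pi (fun _ : Fin 3 => ContinuousLinearMap.id ℝ (Fin 4 → ℝ))
  have hT_apply : ∀ z, T z = fun _ => z := fun z => rfl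
  have hT_norm : ∀ z, ‖T z‖ = ‖z‖ := fun z => by rw [hT_apply]; exact pi_norm_const z
  have hM_apply : ∀ v : Fin 3 → (Fin 4 → ℝ), M v = v 0 0 * ∑ j : Fin 3, v 1 j.succ * v 2 j.succ := by
    intro v
    simp [M, leg, Finset.mul_sum]
  have hproj : ∀ k : Fin 4, ‖ContinuousLinearMap.proj (R := ℝ) (φ := fun _ : Fin 4 => ℝ) k‖ ≤ 1 :=
    fun k => ContinuousLinearMap.opNorm_le_bound _ zero_le_one (fun z => by
      rw [one_mul, ContinuousLinearMap.proj_apply]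
      exact norm_le_pi_norm z k)
  refine ⟨M, T, ?_, ?_, hT_norm, ?_⟩
  · refine le_trans (norm_sum_le _ _) ?_
    have h : ∀ j ∈ (Finset.univ : Finset (Fin 3)),
        ‖(ContinuousMultilinearMap.mkPiAlgebraFin ℝ 3 ℝ).compContinuousLinearMap
          (fun i : Fin 3 => ContinuousLinearMap.proj (R := ℝ) (φ := fun _ : Fin 4 => ℝ)
            (leg j i))‖ ≤ 1 := by
      intro j _
      refine le_trans (ContinuousMultilinearMap.norm_compContinuousLinearMap_le _ _) ?_
      rw [ContinuousMultilinearMap.norm_mkPiAlgebraFin, one_mul]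
      exact Finset.prod_le_one (fun i _ => norm_nonneg _) (fun i _ => hproj _)
    refine le_trans (Finset.sum_le_sum h) ?_
    simp
  · exact ContinuousLinearMap.opNorm_le_bound _ zero_le_one (fun z => by rw [hT_norm, one_mul])
  · funext z
    rw [Function.comp_apply, hT_apply, hM_apply, berryVertex]
    simp only [pow_two]

/-- `𝒜` is smooth. -/
theorem contDiff_berryVertex {m : WithTop ℕ∞} : ContDiff ℝ m berryVertex := by
  obtain ⟨M, T, -, -, -, h⟩ := berryVertex_eq_multilinear_comp
  rw [h]
  exact M.contDiff.comp T.contDiff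

/-- `‖D^i 𝒜(z)‖ ≤ 18 (1 + ‖z‖)²` for every `i ≥ 1`. -/
theorem norm_iteratedFDeriv_berryVertex_le {i : ℕ} (hi : 1 ≤ i) (z : Fin 4 → ℝ) :
    ‖iteratedFDeriv ℝ i berryVertex z‖ ≤ 18 * (1 + ‖z‖) ^ 2 := by
  obtain ⟨M, T, hM, hT, hTz, h⟩ := berryVertex_eq_multilinear_comp
  rw [h, T.iteratedFDeriv_comp_right (M.contDiff (n := ⊤)) z (i := i) le_top]
  refine le_trans (ContinuousMultilinearMap.norm_compContinuousLinearMap_le _ _) ?_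
  have h1 := M.norm_iteratedFDeriv_le i (T z)
  simp only [Fintype.card_fin] at h1
  rw [hTz] at h1
  have hprod : ∏ _k : Fin i, ‖T‖ ≤ 1 :=
    Finset.prod_le_one (fun _ _ => norm_nonneg _) (fun _ _ => hT)
  have hz : 0 ≤ ‖z‖ := norm_nonneg z
  have hdesc : (Nat.descFactorial 3 i : ℝ) ≤ 6 := by
    rcases le_or_gt i 3 with h | h
    · interval_cases i <;> norm_num [Nat.descFactorial]
    · rw [Nat.descFactorial_eq_zero_iff_lt.mpr h]; norm_num
  have hpow : ‖z‖ ^ (3 - i) ≤ (1 + ‖z‖) ^ 2 := by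
    have h3i : 3 - i ≤ 2 := by omega
    calc ‖z‖ ^ (3 - i) ≤ (1 + ‖z‖) ^ (3 - i) := pow_le_pow_left₀ hz (by linarith) _
      _ ≤ (1 + ‖z‖) ^ 2 := pow_le_pow_right₀ (by linarith) h3i
  have hA : ‖iteratedFDeriv ℝ i (fun v => M v) (T z)‖ ≤ 6 * 3 * (1 + ‖z‖) ^ 2 := by
    calc ‖iteratedFDeriv ℝ i (fun v => M v) (T z)‖
        ≤ (Nat.descFactorial 3 i : ℝ) * ‖M‖ * ‖z‖ ^ (3 - i) := h1
      _ ≤ 6 * 3 * (1 + ‖z‖) ^ 2 := by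
          apply mul_le_mul (mul_le_mul hdesc hM (norm_nonneg _) (by norm_num)) hpow
            (pow_nonneg hz _) (by norm_num)
  calc ‖iteratedFDeriv ℝ i (fun v => M v) (T z)‖ * ∏ _k : Fin i, ‖T‖
      ≤ 6 * 3 * (1 + ‖z‖) ^ 2 * 1 :=
        mul_le_mul hA hprod (Finset.prod_nonneg (fun _ _ => norm_nonneg _)) (by positivity)
    _ = 18 * (1 + ‖z‖) ^ 2 := by ring

/-! ### Derivative bounds for `𝒦_g = exp ∘ (−i g 𝒜) − 1`
All real-Fréchet derivatives of `exp : ℂ → ℂ` at a purely imaginary point have norm `1`, so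
Mathlib's bound for iterated derivatives of a composition gives
`‖D^k 𝒦_1(y)‖ ≤ k!·(18(1+‖y‖)²)^k` (`k ≥ 1`); the coupling is then restored by the homogeneity
`𝒦_g = 𝒦_1 ∘ (g^{1/3}·id)`, which produces the small factor `g^{k/3} ≤ g^{1/3}`. -/

/-- All real-Fréchet derivatives of `Complex.exp` at `w` have operator norm `exp (Re w)`. -/
theorem norm_iteratedFDeriv_cexp (i : ℕ) (w : ℂ) :
    ‖iteratedFDeriv ℝ i Complex.exp w‖ = Real.exp w.re := by
  have h := (Complex.contDiff_exp (𝕜 := ℂ) (n := i)).contDiffAt (x := w)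
  rw [← h.restrictScalars_iteratedFDeriv (𝕜 := ℝ), Function.comp_apply,
    ContinuousMultilinearMap.norm_restrictScalars, norm_iteratedFDeriv_eq_norm_iteratedDeriv,
    iteratedDeriv_eq_iterate, Complex.iter_deriv_exp, Complex.norm_exp]

/-- The phase `t ↦ −i g t` as a real-linear map `ℝ → ℂ` of norm `≤ |g|`, through which
`𝒦_g = exp ∘ (phase ∘ 𝒜) + (−1)`. -/
theorem pertK_eq_exp_comp (g : ℝ) :
    ∃ P : ℝ →L[ℝ] ℂ, ‖P‖ ≤ |g| ∧ (∀ t, P t = -(Complex.I * ((g * t : ℝ) : ℂ))) ∧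
      pertK g = (Complex.exp ∘ ((fun t => P t) ∘ berryVertex)) + (fun _ => (-1 : ℂ)) := by
  let P : ℝ →L[ℝ] ℂ := (-(Complex.I * (g : ℂ))) • Complex.ofRealCLM
  have hP : ∀ t, P t = -(Complex.I * ((g * t : ℝ) : ℂ)) := fun t => by
    simp only [P, FunLike.coe_smul, Pi.smul_apply, Complex.ofRealCLM_apply, smul_eq_mul,
      Complex.ofReal_mul]
    ring
  refine ⟨P, ?_, hP, ?_⟩
  · refine ContinuousLinearMap.opNorm_le_bound _ (abs_nonneg g) (fun t => ?_)
    rw [hP, norm_neg, norm_mul, Complex.norm_I, one_mul, Complex.norm_real, norm_mul,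
      Real.norm_eq_abs]
  · funext z
    simp only [pertK, Pi.add_apply, Function.comp_apply, hP]
    ring

/-- `𝒦_g` is smooth. -/
theorem contDiff_pertK {m : WithTop ℕ∞} (g : ℝ) : ContDiff ℝ m (pertK g) := by
  obtain ⟨P, -, -, h⟩ := pertK_eq_exp_comp g
  rw [h]
  exact ((Complex.contDiff_exp (𝕜 := ℝ)).comp (P.contDiff.comp contDiff_berryVertex)).add
    contDiff_const

/-- `‖D^k 𝒦_1(y)‖ ≤ k! · (18 (1+‖y‖)²)^k` for `k ≥ 1`. -/
theorem norm_iteratedFDeriv_pertK_one_le {k : ℕ} (hk : 1 ≤ k) (y : Fin 4 → ℝ) :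
    ‖iteratedFDeriv ℝ k (pertK 1) y‖ ≤ (k.factorial : ℝ) * (18 * (1 + ‖y‖) ^ 2) ^ k := by
  obtain ⟨P, hPn, hP, h⟩ := pertK_eq_exp_comp 1
  have hphase : ∀ {m : WithTop ℕ∞}, ContDiff ℝ m ((fun t => P t) ∘ berryVertex) :=
    P.contDiff.comp contDiff_berryVertex
  rw [h, iteratedFDeriv_add ((Complex.contDiff_exp (𝕜 := ℝ)).comp hphase) contDiff_const,
    iteratedFDeriv_const_of_ne (by omega : k ≠ 0), Pi.add_apply, Pi.zero_apply, add_zero]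
  have hC : ∀ i, i ≤ k → ‖iteratedFDeriv ℝ i Complex.exp (((fun t => P t) ∘ berryVertex) y)‖ ≤ 1 := by
    intro i _
    rw [norm_iteratedFDeriv_cexp, Function.comp_apply, hP, one_mul]
    simp
  have hP1 : ‖P‖ ≤ 1 := by simpa using hPn
  have hD : ∀ i, 1 ≤ i → i ≤ k →
      ‖iteratedFDeriv ℝ i ((fun t => P t) ∘ berryVertex) y‖ ≤ (18 * (1 + ‖y‖) ^ 2) ^ i := by
    intro i hi _
    rw [P.iteratedFDeriv_comp_left ((contDiff_berryVertex (m := ⊤)).contDiffAt (x := y))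
      (i := i) le_top]
    refine le_trans (ContinuousLinearMap.norm_compContinuousMultilinearMap_le _ _) ?_
    have h18 : (1 : ℝ) ≤ 18 * (1 + ‖y‖) ^ 2 := by nlinarith [norm_nonneg y]
    calc ‖P‖ * ‖iteratedFDeriv ℝ i berryVertex y‖ ≤ 1 * (18 * (1 + ‖y‖) ^ 2) :=
          mul_le_mul hP1 (norm_iteratedFDeriv_berryVertex_le hi y) (norm_nonneg _) zero_le_one
      _ = (18 * (1 + ‖y‖) ^ 2) ^ 1 := by rw [one_mul, pow_one]
      _ ≤ (18 * (1 + ‖y‖) ^ 2) ^ i := pow_le_pow_right₀ h18 hi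
  have h := norm_iteratedFDeriv_comp_le (Complex.contDiff_exp (𝕜 := ℝ)) hphase
    (n := k) (N := ⊤) le_top y hC hD
  simpa using h

/-- Scaling of derivatives: `‖D^k 𝒦_g(z)‖ ≤ ‖D^k 𝒦_1(c z)‖ · |c|^k` for `c³ = g`. -/
theorem norm_iteratedFDeriv_pertK_le_scaled {g c : ℝ} (hc : c ^ 3 = g) (k : ℕ) (z : Fin 4 → ℝ) :
    ‖iteratedFDeriv ℝ k (pertK g) z‖ ≤ ‖iteratedFDeriv ℝ k (pertK 1) (c • z)‖ * |c| ^ k := by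
  rw [pertK_eq_comp_smul hc, (c • ContinuousLinearMap.id ℝ (Fin 4 → ℝ)).iteratedFDeriv_comp_right
    (contDiff_pertK (m := ⊤) 1) z (i := k) le_top]
  refine le_trans (ContinuousMultilinearMap.norm_compContinuousLinearMap_le _ _) ?_
  have hT : ‖c • ContinuousLinearMap.id ℝ (Fin 4 → ℝ)‖ ≤ |c| := by
    rw [norm_smul, Real.norm_eq_abs]
    exact mul_le_of_le_one_right (abs_nonneg c) ContinuousLinearMap.norm_id_le
  have hTz : (c • ContinuousLinearMap.id ℝ (Fin 4 → ℝ)) z = c • z := rfl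
  rw [hTz, Finset.prod_const, Finset.card_univ, Fintype.card_fin]
  exact mul_le_mul_of_nonneg_left (pow_le_pow_left₀ (norm_nonneg _) hT k) (norm_nonneg _)

/-- `|𝒜(z)| ≤ 3‖z‖³`. -/
theorem abs_berryVertex_le (z : Fin 4 → ℝ) : |berryVertex z| ≤ 3 * ‖z‖ ^ 3 := by
  unfold berryVertex
  have h0 : |z 0| ≤ ‖z‖ := by rw [← Real.norm_eq_abs]; exact norm_le_pi_norm z 0
  have hj : ∀ j : Fin 3, (z j.succ) ^ 2 ≤ ‖z‖ ^ 2 := fun j => by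
    rw [← sq_abs, ← Real.norm_eq_abs]
    exact pow_le_pow_left₀ (norm_nonneg _) (norm_le_pi_norm z j.succ) 2
  have hsum : ∑ j : Fin 3, (z j.succ) ^ 2 ≤ 3 * ‖z‖ ^ 2 := by
    calc ∑ j : Fin 3, (z j.succ) ^ 2 ≤ ∑ _j : Fin 3, ‖z‖ ^ 2 := Finset.sum_le_sum (fun j _ => hj j)
      _ = 3 * ‖z‖ ^ 2 := by simp
  have hsum0 : 0 ≤ ∑ j : Fin 3, (z j.succ) ^ 2 := Finset.sum_nonneg (fun j _ => sq_nonneg _)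
  rw [abs_mul, abs_of_nonneg hsum0]
  calc |z 0| * ∑ j : Fin 3, (z j.succ) ^ 2 ≤ ‖z‖ * (3 * ‖z‖ ^ 2) :=
        mul_le_mul h0 hsum hsum0 (norm_nonneg _)
    _ = 3 * ‖z‖ ^ 3 := by ring

/-- Order zero: `‖𝒦_g(z)‖ ≤ 3 g ‖z‖³` for `g ≥ 0` (`|e^{iθ} − 1| ≤ |θ|`). -/
theorem norm_pertK_le {g : ℝ} (hg : 0 ≤ g) (z : Fin 4 → ℝ) : ‖pertK g z‖ ≤ 3 * g * ‖z‖ ^ 3 := by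
  unfold pertK
  have h : -(Complex.I * ((g * berryVertex z : ℝ) : ℂ))
      = Complex.I * ((-(g * berryVertex z) : ℝ) : ℂ) := by
    push_cast
    ring
  rw [h]
  refine le_trans (Real.norm_exp_I_mul_ofReal_sub_one_le (x := -(g * berryVertex z))) ?_
  rw [Real.norm_eq_abs, abs_neg, abs_mul, abs_of_nonneg hg]
  calc g * |berryVertex z| ≤ g * (3 * ‖z‖ ^ 3) := mul_le_mul_of_nonneg_left (abs_berryVertex_le z) hg
    _ = 3 * g * ‖z‖ ^ 3 := by ring

end Summit.HubbardSuperconductivity.HubbardSuperconductivity.Theorems.ComplexGFF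

end
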